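import Summits.CriticalPhenomena.PercolationContinuityZ3.Theorems.PercNearOneGluingNoHeavyLowerTailFourPointRelabelExchange
import Summits.CriticalPhenomena.PercolationContinuityZ3.Theorems.PercNearOneGluingNoHeavyLowerTailQ44SingleSourceLawAllN
import Summits.CriticalPhenomena.PercolationContinuityZ3.Theorems.PercNearOneGluingNoHeavyLowerTailFourPointExchangeD
import HarnessLib

/-!
# Strengthened single-source packing laws: `SS7` absorbs extra sides (all `n`, every finite weighted graph)

Support file for crux `stmt-CriticalPhenomena-4575` (master-family programme, row `Q44` / Conjecture W direction; the
single-source law `SS7` = `SingleSourceLaw.pack_singleSource`, seat `prim-l12-p6` gen 24), seat `prim-bnk-1` gen 34; memo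
`run/shared/lean/prim/prim-l12/FROM-prim-bnk-1-gen34-W-ZERO-VARIETY.md` §2.

Cells `cᵢ = FourPointAtoms.cell w a b c y i` (`pat4`: `0 a|b|c|y, 1 a|b|cy, 2 a|by|c, 3 a|bc|y, 4 ay|b|c, 5 ac|b|y, 6 ab|c|y,
7 a|bcy, 8 ay|bc, 9 ac|by, 10 acy|b, 11 ab|cy, 12 aby|c, 13 abc|y, 14 abcy`).  `SS7` is
`c₆c₇ + c₅c₇ + c₁₁c₉ + c₁₁c₈ + c₆c₈ + c₆c₁ + c₈c₁ ≤ (c₁₁ + c₁₄)·c₀`.  `prim-bnk-1` gen 33 (memo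
`FROM-prim-bnk-1-gen33-LAW-LEVEL-MONO-A.md` §5c, census request `ttrl/requests.jsonl` l.3846) conjectured that the law tolerates eight
single extra sides `{c₆c₉, c₆c₁₀, c₅c₁₁, c₅c₈, c₅c₁₂, c₄c₁₁, c₄c₉, c₂c₈}` (0 negatives in 82 293 120 exact instances each, cp-front4 kit
j202359).  PROVED HERE, for every finite weighted graph on `Fin n` and all marked points:
* `pack_singleSource_x69_x610`  : `SS7-sides + c₆c₉ + c₆c₁₀ ≤ (c₁₁+c₁₄)c₀`  (`= Q44b + [c₁c₈ ≤ c₄c₇]`, exact);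
* `pack_singleSource_x69_x511`  : `SS7-sides + c₆c₉ + c₅c₁₁ ≤ (c₁₁+c₁₄)c₀`  (`= Q44b + [c₁c₈ ≤ c₄c₇] + [c₅c₁₁ ≤ c₆c₁₀]`);
* `pack_singleSource_x69_x411`  : `SS7-sides + c₆c₉ + c₄c₁₁ ≤ (c₁₁+c₁₄)c₀`  (`= Q44b + [c₁c₈ ≤ c₄c₇] + [c₄c₁₁ ≤ c₆c₁₀]`);
* `pack_singleSource_x69_x610_x28` : `SS7-sides + c₆c₉ + c₆c₁₀ + c₂c₈ ≤ (c₁₁+c₁₄)c₀` — degree-3 certificate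
  `(c₃+c₇+c₈)·[goods − sides] = c₇·R_B + c₈·R_A + (c₃+c₇+c₈)·Q44b` with the two van den Berg–Häggström–Kahn rows
  `R_A = SingleSourceLaw.rowA`, `R_B = SingleSourceLaw.rowB` of the SS7 file; the degenerate case `c₃+c₇+c₈ = 0` forces `c₈ = 0`
  and reduces to the first theorem.
Ingredients: `TwoCopyMono.q44b_pack_nine` (prim-bnk-1 gen 19), the two-set exchange row `Q44TopGood.exch_c1c8_le_c4c7` (prim-l12-p6
gen 25) and two further relabelled instances of `FourPointExchange.typeD_cell` (prim-bnk-1 gen 33) proved here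
(`exch_c5c11_le_c6c10`, `exch_c4c11_le_c6c10`, via the relabelling dictionaries `cell_relabel_byac/bcay` in the style of
`Q44TopGood.cell_relabel_*`).  Certificates found by LP (kit j218715 / j218742, exact rationals).  NOT provable this way (no
certificate of degree ≤ 3 over the law-level dictionary {Harris, BHK 2006 Thms 1.1/2.1, Gladkov sunflowers, atlas A–G, Q44b, SS7,
W⁺, N2, complementary pairs}): the extras `c₅c₈`, `c₄c₉`, the six-sum, and `c₅c₁₂` — the last has an exact pseudo-law (kit j218742,
`SS7 − c₅c₁₂ = −0.0054` with all 124 749 rows ≥ 0), so it is independent of everything law-level in the tree; all remain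
census-true conjectures.  No sorries, no new definitions, standard axioms.
-/

noncomputable section

namespace Summit.CriticalPhenomena.PercolationContinuityZ3.Theorems

namespace SingleSourceStrong

open MeasureTheory Set Literature.Probability.Percolation
open Literature.Probability.LatticeModels (prodBernoulli)
open FourPointAtoms
open Summit.CriticalPhenomena.PercolationContinuityZ3.Cruxes.AdditiveGluing.TieLine.ConnAtoms
open scoped Classical

variable {n : ℕ}

/-- Cells of the relabelled quadruple `(b y a c)` in the cells of `(a,b,c,y)`. [folklore] -/
theorem cell_relabel_byac (w : Sym2 (Fin n) → unitInterval) (a b c y : Fin n) (i : Fin 15) :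
    cell w b y a c i =
      (if (∀ j k : Fin 4, pat4 0 ((![1, 3, 0, 2] : Fin 4 → Fin 4) j) = pat4 0 ((![1, 3, 0, 2] : Fin 4 → Fin 4) k) ↔ pat4 i j = pat4 i k) then cell w a b c y 0 else 0) +
      (if (∀ j k : Fin 4, pat4 1 ((![1, 3, 0, 2] : Fin 4 → Fin 4) j) = pat4 1 ((![1, 3, 0, 2] : Fin 4 → Fin 4) k) ↔ pat4 i j = pat4 i k) then cell w a b c y 1 else 0) +
      (if (∀ j k : Fin 4, pat4 2 ((![1, 3, 0, 2] : Fin 4 → Fin 4) j) = pat4 2 ((![1, 3, 0, 2] : Fin 4 → Fin 4) k) ↔ pat4 i j = pat4 i k) then cell w a b c y 2 else 0) +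
      (if (∀ j k : Fin 4, pat4 3 ((![1, 3, 0, 2] : Fin 4 → Fin 4) j) = pat4 3 ((![1, 3, 0, 2] : Fin 4 → Fin 4) k) ↔ pat4 i j = pat4 i k) then cell w a b c y 3 else 0) +
      (if (∀ j k : Fin 4, pat4 4 ((![1, 3, 0, 2] : Fin 4 → Fin 4) j) = pat4 4 ((![1, 3, 0, 2] : Fin 4 → Fin 4) k) ↔ pat4 i j = pat4 i k) then cell w a b c y 4 else 0) +
      (if (∀ j k : Fin 4, pat4 5 ((![1, 3, 0, 2] : Fin 4 → Fin 4) j) = pat4 5 ((![1, 3, 0, 2] : Fin 4 → Fin 4) k) ↔ pat4 i j = pat4 i k) then cell w a b c y 5 else 0) +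
      (if (∀ j k : Fin 4, pat4 6 ((![1, 3, 0, 2] : Fin 4 → Fin 4) j) = pat4 6 ((![1, 3, 0, 2] : Fin 4 → Fin 4) k) ↔ pat4 i j = pat4 i k) then cell w a b c y 6 else 0) +
      (if (∀ j k : Fin 4, pat4 7 ((![1, 3, 0, 2] : Fin 4 → Fin 4) j) = pat4 7 ((![1, 3, 0, 2] : Fin 4 → Fin 4) k) ↔ pat4 i j = pat4 i k) then cell w a b c y 7 else 0) +
      (if (∀ j k : Fin 4, pat4 8 ((![1, 3, 0, 2] : Fin 4 → Fin 4) j) = pat4 8 ((![1, 3, 0, 2] : Fin 4 → Fin 4) k) ↔ pat4 i j = pat4 i k) then cell w a b c y 8 else 0) +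
      (if (∀ j k : Fin 4, pat4 9 ((![1, 3, 0, 2] : Fin 4 → Fin 4) j) = pat4 9 ((![1, 3, 0, 2] : Fin 4 → Fin 4) k) ↔ pat4 i j = pat4 i k) then cell w a b c y 9 else 0) +
      (if (∀ j k : Fin 4, pat4 10 ((![1, 3, 0, 2] : Fin 4 → Fin 4) j) = pat4 10 ((![1, 3, 0, 2] : Fin 4 → Fin 4) k) ↔ pat4 i j = pat4 i k) then cell w a b c y 10 else 0) +
      (if (∀ j k : Fin 4, pat4 11 ((![1, 3, 0, 2] : Fin 4 → Fin 4) j) = pat4 11 ((![1, 3, 0, 2] : Fin 4 → Fin 4) k) ↔ pat4 i j = pat4 i k) then cell w a b c y 11 else 0) +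
      (if (∀ j k : Fin 4, pat4 12 ((![1, 3, 0, 2] : Fin 4 → Fin 4) j) = pat4 12 ((![1, 3, 0, 2] : Fin 4 → Fin 4) k) ↔ pat4 i j = pat4 i k) then cell w a b c y 12 else 0) +
      (if (∀ j k : Fin 4, pat4 13 ((![1, 3, 0, 2] : Fin 4 → Fin 4) j) = pat4 13 ((![1, 3, 0, 2] : Fin 4 → Fin 4) k) ↔ pat4 i j = pat4 i k) then cell w a b c y 13 else 0) +
      (if (∀ j k : Fin 4, pat4 14 ((![1, 3, 0, 2] : Fin 4 → Fin 4) j) = pat4 14 ((![1, 3, 0, 2] : Fin 4 → Fin 4) k) ↔ pat4 i j = pat4 i k) then cell w a b c y 14 else 0) := by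
  unfold cell; rw [measureReal_eq_cellSum w a b c y (Q44TopGood.hasPattern_atom_perm (![1, 3, 0, 2] : Fin 4 → Fin 4) a b c y (q' := quad b y a c)
    (by intro j; fin_cases j <;> rfl) (pat4 i))]; rfl

/-- Cells of the relabelled quadruple `(b c a y)` in the cells of `(a,b,c,y)`. [folklore] -/
theorem cell_relabel_bcay (w : Sym2 (Fin n) → unitInterval) (a b c y : Fin n) (i : Fin 15) :
    cell w b c a y i =
      (if (∀ j k : Fin 4, pat4 0 ((![1, 2, 0, 3] : Fin 4 → Fin 4) j) = pat4 0 ((![1, 2, 0, 3] : Fin 4 → Fin 4) k) ↔ pat4 i j = pat4 i k) then cell w a b c y 0 else 0) +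
      (if (∀ j k : Fin 4, pat4 1 ((![1, 2, 0, 3] : Fin 4 → Fin 4) j) = pat4 1 ((![1, 2, 0, 3] : Fin 4 → Fin 4) k) ↔ pat4 i j = pat4 i k) then cell w a b c y 1 else 0) +
      (if (∀ j k : Fin 4, pat4 2 ((![1, 2, 0, 3] : Fin 4 → Fin 4) j) = pat4 2 ((![1, 2, 0, 3] : Fin 4 → Fin 4) k) ↔ pat4 i j = pat4 i k) then cell w a b c y 2 else 0) +
      (if (∀ j k : Fin 4, pat4 3 ((![1, 2, 0, 3] : Fin 4 → Fin 4) j) = pat4 3 ((![1, 2, 0, 3] : Fin 4 → Fin 4) k) ↔ pat4 i j = pat4 i k) then cell w a b c y 3 else 0) +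
      (if (∀ j k : Fin 4, pat4 4 ((![1, 2, 0, 3] : Fin 4 → Fin 4) j) = pat4 4 ((![1, 2, 0, 3] : Fin 4 → Fin 4) k) ↔ pat4 i j = pat4 i k) then cell w a b c y 4 else 0) +
      (if (∀ j k : Fin 4, pat4 5 ((![1, 2, 0, 3] : Fin 4 → Fin 4) j) = pat4 5 ((![1, 2, 0, 3] : Fin 4 → Fin 4) k) ↔ pat4 i j = pat4 i k) then cell w a b c y 5 else 0) +
      (if (∀ j k : Fin 4, pat4 6 ((![1, 2, 0, 3] : Fin 4 → Fin 4) j) = pat4 6 ((![1, 2, 0, 3] : Fin 4 → Fin 4) k) ↔ pat4 i j = pat4 i k) then cell w a b c y 6 else 0) +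
      (if (∀ j k : Fin 4, pat4 7 ((![1, 2, 0, 3] : Fin 4 → Fin 4) j) = pat4 7 ((![1, 2, 0, 3] : Fin 4 → Fin 4) k) ↔ pat4 i j = pat4 i k) then cell w a b c y 7 else 0) +
      (if (∀ j k : Fin 4, pat4 8 ((![1, 2, 0, 3] : Fin 4 → Fin 4) j) = pat4 8 ((![1, 2, 0, 3] : Fin 4 → Fin 4) k) ↔ pat4 i j = pat4 i k) then cell w a b c y 8 else 0) +
      (if (∀ j k : Fin 4, pat4 9 ((![1, 2, 0, 3] : Fin 4 → Fin 4) j) = pat4 9 ((![1, 2, 0, 3] : Fin 4 → Fin 4) k) ↔ pat4 i j = pat4 i k) then cell w a b c y 9 else 0) +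
      (if (∀ j k : Fin 4, pat4 10 ((![1, 2, 0, 3] : Fin 4 → Fin 4) j) = pat4 10 ((![1, 2, 0, 3] : Fin 4 → Fin 4) k) ↔ pat4 i j = pat4 i k) then cell w a b c y 10 else 0) +
      (if (∀ j k : Fin 4, pat4 11 ((![1, 2, 0, 3] : Fin 4 → Fin 4) j) = pat4 11 ((![1, 2, 0, 3] : Fin 4 → Fin 4) k) ↔ pat4 i j = pat4 i k) then cell w a b c y 11 else 0) +
      (if (∀ j k : Fin 4, pat4 12 ((![1, 2, 0, 3] : Fin 4 → Fin 4) j) = pat4 12 ((![1, 2, 0, 3] : Fin 4 → Fin 4) k) ↔ pat4 i j = pat4 i k) then cell w a b c y 12 else 0) +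
      (if (∀ j k : Fin 4, pat4 13 ((![1, 2, 0, 3] : Fin 4 → Fin 4) j) = pat4 13 ((![1, 2, 0, 3] : Fin 4 → Fin 4) k) ↔ pat4 i j = pat4 i k) then cell w a b c y 13 else 0) +
      (if (∀ j k : Fin 4, pat4 14 ((![1, 2, 0, 3] : Fin 4 → Fin 4) j) = pat4 14 ((![1, 2, 0, 3] : Fin 4 → Fin 4) k) ↔ pat4 i j = pat4 i k) then cell w a b c y 14 else 0) := by
  unfold cell; rw [measureReal_eq_cellSum w a b c y (Q44TopGood.hasPattern_atom_perm (![1, 2, 0, 3] : Fin 4 → Fin 4) a b c y (q' := quad b c a y)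
    (by intro j; fin_cases j <;> rfl) (pat4 i))]; rfl

/-- Type D for the quadruple `(b y a c)`: `μ(ac|b|y)·μ(ab|cy) ≤ μ(ab|c|y)·μ(acy|b)`, i.e. `c₅c₁₁ ≤ c₆c₁₀`. [this work] -/
theorem exch_c5c11_le_c6c10 (w : Sym2 (Fin n) → unitInterval) (a b c y : Fin n) :
    cell w a b c y 5 * cell w a b c y 11 ≤ cell w a b c y 6 * cell w a b c y 10 := by
  have h := FourPointExchange.typeD_cell w b y a c
  rw [cell_relabel_byac w a b c y 1, cell_relabel_byac w a b c y 9, cell_relabel_byac w a b c y 5,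
    cell_relabel_byac w a b c y 7] at h
  simp (config := {decide := true}) only [ite_true, ite_false, zero_add, add_zero] at h
  linarith

/-- Type D for the quadruple `(b c a y)`: `μ(ay|b|c)·μ(ab|cy) ≤ μ(ab|c|y)·μ(acy|b)`, i.e. `c₄c₁₁ ≤ c₆c₁₀`. [this work] -/
theorem exch_c4c11_le_c6c10 (w : Sym2 (Fin n) → unitInterval) (a b c y : Fin n) :
    cell w a b c y 4 * cell w a b c y 11 ≤ cell w a b c y 6 * cell w a b c y 10 := by
  have h := FourPointExchange.typeD_cell w b c a y
  rw [cell_relabel_bcay w a b c y 1, cell_relabel_bcay w a b c y 9, cell_relabel_bcay w a b c y 5,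
    cell_relabel_bcay w a b c y 7] at h
  simp (config := {decide := true}) only [ite_true, ite_false, zero_add, add_zero] at h
  linarith

/-! ## The strengthened laws -/

/-- **SS7 absorbs `μ(ab|c|y)·[μ(ac|by) + μ(acy|b)]`**: `c₆c₇ + c₅c₇ + c₁₁c₉ + c₁₁c₈ + c₆c₈ + c₆c₁ + c₈c₁ + c₆c₉ + c₆c₁₀ ≤ (c₁₁+c₁₄)c₀`
on every finite weighted graph (`= Q44b + [c₁c₈ ≤ c₄c₇]`). [this work] -/
theorem pack_singleSource_x69_x610 (w : Sym2 (Fin n) → unitInterval) (a b c y : Fin n) :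
    cell w a b c y 6 * cell w a b c y 7 + cell w a b c y 5 * cell w a b c y 7 + cell w a b c y 11 * cell w a b c y 9 +
      cell w a b c y 11 * cell w a b c y 8 + cell w a b c y 6 * cell w a b c y 8 + cell w a b c y 6 * cell w a b c y 1 +
      cell w a b c y 8 * cell w a b c y 1 + cell w a b c y 6 * cell w a b c y 9 + cell w a b c y 6 * cell w a b c y 10 ≤
      (cell w a b c y 11 + cell w a b c y 14) * cell w a b c y 0 := by
  have hQ := TwoCopyMono.q44b_pack_nine w a b c y
  have hD := Q44TopGood.exch_c1c8_le_c4c7 w a b c y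
  linear_combination hQ + hD

/-- **SS7 absorbs `μ(ab|c|y)μ(ac|by) + μ(ac|b|y)μ(ab|cy)`**: `SS7-sides + c₆c₉ + c₅c₁₁ ≤ (c₁₁+c₁₄)c₀`
(`= Q44b + [c₁c₈ ≤ c₄c₇] + [c₅c₁₁ ≤ c₆c₁₀]`). [this work] -/
theorem pack_singleSource_x69_x511 (w : Sym2 (Fin n) → unitInterval) (a b c y : Fin n) :
    cell w a b c y 6 * cell w a b c y 7 + cell w a b c y 5 * cell w a b c y 7 + cell w a b c y 11 * cell w a b c y 9 +
      cell w a b c y 11 * cell w a b c y 8 + cell w a b c y 6 * cell w a b c y 8 + cell w a b c y 6 * cell w a b c y 1 +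
      cell w a b c y 8 * cell w a b c y 1 + cell w a b c y 6 * cell w a b c y 9 + cell w a b c y 5 * cell w a b c y 11 ≤
      (cell w a b c y 11 + cell w a b c y 14) * cell w a b c y 0 := by
  have hQ := TwoCopyMono.q44b_pack_nine w a b c y
  have hD := Q44TopGood.exch_c1c8_le_c4c7 w a b c y
  have hD' := exch_c5c11_le_c6c10 w a b c y
  linear_combination hQ + hD + hD'

/-- **SS7 absorbs `μ(ab|c|y)μ(ac|by) + μ(ay|b|c)μ(ab|cy)`**: `SS7-sides + c₆c₉ + c₄c₁₁ ≤ (c₁₁+c₁₄)c₀`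
(`= Q44b + [c₁c₈ ≤ c₄c₇] + [c₄c₁₁ ≤ c₆c₁₀]`). [this work] -/
theorem pack_singleSource_x69_x411 (w : Sym2 (Fin n) → unitInterval) (a b c y : Fin n) :
    cell w a b c y 6 * cell w a b c y 7 + cell w a b c y 5 * cell w a b c y 7 + cell w a b c y 11 * cell w a b c y 9 +
      cell w a b c y 11 * cell w a b c y 8 + cell w a b c y 6 * cell w a b c y 8 + cell w a b c y 6 * cell w a b c y 1 +
      cell w a b c y 8 * cell w a b c y 1 + cell w a b c y 6 * cell w a b c y 9 + cell w a b c y 4 * cell w a b c y 11 ≤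
      (cell w a b c y 11 + cell w a b c y 14) * cell w a b c y 0 := by
  have hQ := TwoCopyMono.q44b_pack_nine w a b c y
  have hD := Q44TopGood.exch_c1c8_le_c4c7 w a b c y
  have hD' := exch_c4c11_le_c6c10 w a b c y
  linear_combination hQ + hD + hD'

/-- **SS7 absorbs `μ(ab|c|y)[μ(ac|by)+μ(acy|b)] + μ(a|by|c)μ(ay|bc)`**:
`SS7-sides + c₆c₉ + c₆c₁₀ + c₂c₈ ≤ (c₁₁+c₁₄)c₀` on every finite weighted graph.  Degree-3 certificate
`(c₃+c₇+c₈)·slack = c₇·R_B + c₈·R_A + (c₃+c₇+c₈)·Q44b` (`SingleSourceLaw.rowA/rowB`, the BHK Thm 2.1 rows of the SS7 file);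
if `c₃+c₇+c₈ = 0` then `c₈ = 0` and the claim is `pack_singleSource_x69_x610`. [this work] -/
theorem pack_singleSource_x69_x610_x28 (w : Sym2 (Fin n) → unitInterval) (a b c y : Fin n) :
    cell w a b c y 6 * cell w a b c y 7 + cell w a b c y 5 * cell w a b c y 7 + cell w a b c y 11 * cell w a b c y 9 +
      cell w a b c y 11 * cell w a b c y 8 + cell w a b c y 6 * cell w a b c y 8 + cell w a b c y 6 * cell w a b c y 1 +
      cell w a b c y 8 * cell w a b c y 1 + cell w a b c y 6 * cell w a b c y 9 + cell w a b c y 6 * cell w a b c y 10 +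
      cell w a b c y 2 * cell w a b c y 8 ≤
      (cell w a b c y 11 + cell w a b c y 14) * cell w a b c y 0 := by
  have hQ := TwoCopyMono.q44b_pack_nine w a b c y
  have hA := SingleSourceLaw.rowA w a b c y
  have hB := SingleSourceLaw.rowB w a b c y
  have c3 := cell_nonneg w a b c y 3
  have c7 := cell_nonneg w a b c y 7
  have c8 := cell_nonneg w a b c y 8
  -- the degree-3 identity
  have key : (cell w a b c y 3 + cell w a b c y 7 + cell w a b c y 8) *
      ((cell w a b c y 11 + cell w a b c y 14) * cell w a b c y 0 -
        (cell w a b c y 6 * cell w a b c y 7 + cell w a b c y 5 * cell w a b c y 7 + cell w a b c y 11 * cell w a b c y 9 +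
          cell w a b c y 11 * cell w a b c y 8 + cell w a b c y 6 * cell w a b c y 8 + cell w a b c y 6 * cell w a b c y 1 +
          cell w a b c y 8 * cell w a b c y 1 + cell w a b c y 6 * cell w a b c y 9 + cell w a b c y 6 * cell w a b c y 10 +
          cell w a b c y 2 * cell w a b c y 8)) =
      cell w a b c y 7 * ((cell w a b c y 4 + cell w a b c y 8) * (cell w a b c y 3 + cell w a b c y 7 + cell w a b c y 8) -
          cell w a b c y 8 * (cell w a b c y 0 + cell w a b c y 1 + cell w a b c y 2 + cell w a b c y 3 + cell w a b c y 4 +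
            cell w a b c y 7 + cell w a b c y 8)) +
      cell w a b c y 8 * (cell w a b c y 7 * (cell w a b c y 0 + cell w a b c y 1 + cell w a b c y 2 + cell w a b c y 3 +
            cell w a b c y 4 + cell w a b c y 7 + cell w a b c y 8) -
          (cell w a b c y 3 + cell w a b c y 7 + cell w a b c y 8) * (cell w a b c y 1 + cell w a b c y 2 + cell w a b c y 7)) +
      (cell w a b c y 3 + cell w a b c y 7 + cell w a b c y 8) * ((cell w a b c y 11 + cell w a b c y 14) * cell w a b c y 0 -
          (cell w a b c y 11 * (cell w a b c y 9 + cell w a b c y 8) +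
            cell w a b c y 6 * (cell w a b c y 9 + cell w a b c y 8 + cell w a b c y 1 + cell w a b c y 10 + cell w a b c y 7) +
            cell w a b c y 7 * (cell w a b c y 5 + cell w a b c y 4))) := by
    ring
  have hcert : 0 ≤ (cell w a b c y 3 + cell w a b c y 7 + cell w a b c y 8) *
      ((cell w a b c y 11 + cell w a b c y 14) * cell w a b c y 0 -
        (cell w a b c y 6 * cell w a b c y 7 + cell w a b c y 5 * cell w a b c y 7 + cell w a b c y 11 * cell w a b c y 9 +
          cell w a b c y 11 * cell w a b c y 8 + cell w a b c y 6 * cell w a b c y 8 + cell w a b c y 6 * cell w a b c y 1 +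
          cell w a b c y 8 * cell w a b c y 1 + cell w a b c y 6 * cell w a b c y 9 + cell w a b c y 6 * cell w a b c y 10 +
          cell w a b c y 2 * cell w a b c y 8)) := by
    rw [key]
    exact add_nonneg (add_nonneg (mul_nonneg c7 (sub_nonneg.2 hB)) (mul_nonneg c8 (sub_nonneg.2 hA)))
      (mul_nonneg (add_nonneg (add_nonneg c3 c7) c8) (sub_nonneg.2 hQ))
  by_cases h0 : cell w a b c y 3 + cell w a b c y 7 + cell w a b c y 8 = 0
  · -- degenerate case: then `c₈ = 0`
    have h8 : cell w a b c y 8 = 0 := by linarith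
    have h1 := pack_singleSource_x69_x610 w a b c y
    rw [h8] at h1 ⊢
    linarith
  · have hpos : 0 < cell w a b c y 3 + cell w a b c y 7 + cell w a b c y 8 :=
      lt_of_le_of_ne (add_nonneg (add_nonneg c3 c7) c8) (Ne.symm h0)
    have := (mul_nonneg_iff_of_pos_left hpos).mp hcert
    linarith

end SingleSourceStrong

end Summit.CriticalPhenomena.PercolationContinuityZ3.Theorems
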